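import Literature.IUT.HodgeTheaters.StableCurveTemperedDataOfSpecialFibreQTower
import HarnessLib

/-!
# [IUTchI] Prop. 2.4 at the genuine 𝔛-datum: the TEMPERED COMPLETENESS binder `hlim` DISCHARGED modulo
# "the admissible kernels shrink to `1`", from [SemiAnbd] Def. 3.1 (i) (`IsTempered`)

Mochizuki, *Inter-universal Teichmüller theory I*, kurims manuscript (May 2020), §2, proof of Prop. 2.4 (i) p. 50
l. 40–42 ("`Π^tp_X` … may be written as an inverse limit of the topological groups `Π^tp_X/Ker(J ↠ Π^tp_{𝔾_J})`")
and proof of (ii) p. 51 l. 6–13 ("just as in the proof of assertion (i) … `γ` lies in `Π^tp_X`")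
([IUTchI] Prop 2.4(i)(ii) pp.50-51) [claim: Mochizuki2012, status: disputed] (D-0012 claim key; nothing of the series is
asserted here), over Mochizuki, *Semi-graphs of anabelioids*, Publ. RIMS **42** (2006), Def. 3.1 (i) p. 33 ("a
topological group … tempered if it may be written as an inverse limit of an inverse system of surjections of countable
discrete topological groups") and Ex. 3.10 pp. 44–45 [cite: MochizukiSemiAnbd2006, Def 3.1(i) p.33].

PROOF-ONLY sequel of `StableCurveTemperedDataOfSpecialFibreQTower.lean` (abc-iut cell, seat abc-iut-w4-d063; L5 NV row
`StableCurveTemperedData.Prop24QTower` at the genuine datum).  There — and in abc-iut-L5-t11's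
`StableCurveTemperedDataOfSpecialFibreTowerKernel.lean` for assertion (i) — the inverse-limit sentence of p. 50 l. 40–42
/ p. 51 l. 8–10 enters as the NAMED binder `hlim`: every sequence `(t_j)` in `Π^temp_{X_K}` that is Cauchy for the
filtration by the closures `admKerHat_j ⊆ Π_{X_K}` of the admissible kernels `admKer_j = Ker(N_j ↠ π₁^temp(𝒢_j))` is
interpolated by one element `s` (`s⁻¹ t_j ∈ admKerHat_j` for all `j`).  THIS FILE PROVES `hlim` from the interface
axiom `IsTempered Π^temp_{X_K}` of L3's `TemperedCurve` (field `GroupLevelData.isTempered`: completeness for compatible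
families of cosets modulo OPEN normal subgroups + open normal subgroups form a basis of neighbourhoods of `1`), the
antitonicity of the admissible kernels (`SpecialFibreTower.admKer_antitone`), their closedness for the profinite
topology (`comap_admKerHat`, hypothesis-free) and ONE transparent interface reading replacing `hlim`:
* `hadm : ∀ U ∈ 𝓝 (1 : Δ^temp_X), ∃ j, admKer_j ⊆ U` — "the admissible kernels shrink to `1`" (the `Ker(N_j ↠
  π₁^temp(𝒢_j))` lie in the kernels `Ker(N_j ↠ π₁^top(𝔾_j))` of André's defining inverse system
  `Δ^temp = lim_j Gal(Ỹ_j^∞/X̄)`, which form a basis of neighbourhoods of `1` when the `N_j` are cofinal; like `hcof`,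
  a reading of [SemiAnbd] Ex. 3.10's "exhaustive sequence" that L3's `SpecialFibreTower` does not record — GAP-LEDGER
  class G-L5t11g6-1 and -3, carried as a hypothesis, never a `Prop` fact).
Main results: `mem_of_forall_mem_openNormal_mul` (in a tempered group a closed subgroup is cut out by the open normal
subgroups: `y ∈ N·K` for all open normal `N` ⇒ `y ∈ K`), `hlimOn_of_admKer_nhds_one` (interpolation on any eventually-full
index set — the shape of abc-iut-L5-t11's `hlim` below a level `W`), `hlim_of_admKer_nhds_one` (the shape of
`qTower_qDetectsTempered`), and the re-keyed capstones `qTower_qDetectsTempered_of_admKer_nhds_one`,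
`prop24ii_ofSpecialFibre_of_admKer_nhds_one` (Prop. 2.4 (ii) AS TYPED at the genuine datum ⇐ `LevelObservation` +
(P0) + `hcof` + `hadm`).  No definitions, no new `Prop` fact; typed ≠ discharged for `hadm`/`hcof`/(P0)/the analytic
input; nothing here bears on [IUTchIII] Cor. 3.12.
-/

noncomputable section

namespace Literature.IUT.HodgeTheaters

namespace StableCurveTemperedData

namespace OfSpecialFibre

open _root_.Topology
open scoped Pointwise
open Literature.AnabelianGeometry.SemiGraphs Literature.AnabelianGeometry.SemiGraphs.ProfiniteSemiGraph

/-! ### A closed subgroup of a tempered group is cut out by the open normal subgroups -/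

/-- **In a tempered group, a CLOSED subgroup `K` is cut out by the open normal subgroups**: if `y ∈ N · K` for every
open normal subgroup `N`, then `y ∈ K` (the open normal subgroups form a basis of neighbourhoods of `1`,
[SemiAnbd] Def. 3.1 (i); if `y ∉ K`, the open set `{g | g·y ∉ K}` contains such an `N`, and `y = n k` gives
`n⁻¹ y = k ∈ K` with `n⁻¹ ∈ N`). [cite: MochizukiSemiAnbd2006, Def 3.1(i) p.33] -/
theorem mem_of_forall_mem_openNormal_mul {G : Type*} [Group G] [TopologicalSpace G] [IsTopologicalGroup G]
    (hG : IsTempered G) (K : Subgroup G) (hK : IsClosed (K : Set G)) {y : G}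
    (h : ∀ N : OpenNormalSubgroup G, y ∈ (N : Set G) * (K : Set G)) : y ∈ K := by
  by_contra hy
  -- the open neighbourhood `U = {g | g * y ∉ K}` of `1`
  have hU : {g : G | g * y ∉ (K : Set G)} ∈ 𝓝 (1 : G) := by
    have hopen : IsOpen {g : G | g * y ∉ (K : Set G)} :=
      (hK.preimage (continuous_mul_const y)).isOpen_compl
    exact hopen.mem_nhds (by simpa using hy)
  obtain ⟨N, -, hNU⟩ := hG.basis _ hU
  obtain ⟨n, hn, k, hk, hnk⟩ := h N
  have hn' : n⁻¹ ∈ (N : Set G) := N.toSubgroup.inv_mem hn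
  have : n⁻¹ * y ∉ (K : Set G) := hNU hn'
  apply this
  rw [← hnk, ← mul_assoc, inv_mul_cancel, one_mul]
  exact hk

variable {p : ℕ} [Fact p.Prime] (X : TemperedCurve p) (T : SpecialFibreTower ↥X.DeltaTemp)

/-! ### Bookkeeping on the admissible kernels -/

/-- `admKerPi` is antitone in the level (the admissible kernels decrease, `admKer_antitone`).
([IUTchI] Prop 2.4(ii) p.51) [claim: Mochizuki2012, status: disputed] -/
theorem admKerPi_antitone : Antitone (admKerPi X T) :=
  fun _ _ hij => Subgroup.map_mono (T.admKer_antitone hij)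

/-- `admKerHat` is antitone in the level. ([IUTchI] Prop 2.4(ii) p.51) [claim: Mochizuki2012, status: disputed] -/
theorem admKerHat_antitone : Antitone (admKerHat X T) :=
  fun _ _ hij => Subgroup.topologicalClosure_mono (Subgroup.map_mono (admKerPi_antitone X T hij))

/-- **`admKer_j` is CLOSED in `Π^temp_{X_K}`**: it is the preimage of its (closed) closure in `Π_{X_K}`
(`comap_admKerHat`, hypothesis-free). ([IUTchI] Prop 2.4(ii) p.51) [claim: Mochizuki2012, status: disputed] -/
theorem isClosed_admKerPi (d : X.GroupLevelData) (j : ℕ) : IsClosed ((admKerPi X T j : Subgroup X.PiTemp) : Set X.PiTemp) := by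
  rw [← comap_admKerHat X T d j, Subgroup.coe_comap]
  exact (Subgroup.isClosed_topologicalClosure _).preimage X.toHat.continuous

/-- Membership transfer: `ι(x) ∈ admKerHat_j ↔ x ∈ admKerPi_j` (`comap_admKerHat`).
([IUTchI] Prop 2.4(ii) p.51) [claim: Mochizuki2012, status: disputed] -/
theorem toHat_mem_admKerHat_iff (d : X.GroupLevelData) (j : ℕ) (x : X.PiTemp) :
    X.toHat x ∈ admKerHat X T j ↔ x ∈ admKerPi X T j := by
  rw [← comap_admKerHat X T d j, Subgroup.mem_comap]
  rfl

/-- **"The admissible kernels shrink to `1`" read in `Π^temp_{X_K}`**: under `hadm`, every open normal subgroup of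
`Π^temp_{X_K}` contains some `admKer_j` (its trace on `Δ^temp_X` is a neighbourhood of `1`).
[cite: MochizukiSemiAnbd2006, Ex 3.10 p.44] -/
theorem exists_admKerPi_le_openNormal
    (hadm : ∀ U ∈ 𝓝 (1 : ↥X.DeltaTemp), ∃ j, ((T.admKer j : Subgroup ↥X.DeltaTemp) : Set ↥X.DeltaTemp) ⊆ U)
    (N : OpenNormalSubgroup X.PiTemp) : ∃ j, admKerPi X T j ≤ N.toSubgroup := by
  have hN : ((↑) : ↥X.DeltaTemp → X.PiTemp) ⁻¹' (N : Set X.PiTemp) ∈ 𝓝 (1 : ↥X.DeltaTemp) :=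
    (N.isOpen'.preimage continuous_subtype_val).mem_nhds (by
      rw [Set.mem_preimage, OneMemClass.coe_one]
      exact N.toSubgroup.one_mem)
  obtain ⟨j, hj⟩ := hadm _ hN
  refine ⟨j, ?_⟩
  rintro _ ⟨a, ha, rfl⟩
  exact hj ha

/-! ### The interpolation: `hlim` from `IsTempered` + `hadm` -/

/-- **TEMPERED COMPLETENESS along the admissible kernels, on an eventually-full index set.**  Under `hadm`, for any
index set `J ⊇ [i₀, ∞)` and any sequence `(t_i)` in `Π^temp_{X_K}` that is Cauchy ALONG `J` for the filtration by the
closures `admKerHat_i` (`ι(t_i⁻¹ t_j) ∈ admKerHat_i` for `i ≤ j` in `J`), there is `s ∈ Π^temp_{X_K}` with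
`ι(s⁻¹ t_i) ∈ admKerHat_i` for every `i ∈ J` ("`Π^tp_X` … may be written as an inverse limit of the topological groups
`Π^tp_X/Ker(J ↠ Π^tp_{𝔾_J})`", p. 50 l. 40–42).  Proof: for each open normal `N ⊆ Π^temp_{X_K}` pick `j(N) ∈ J` with
`admKer_{j(N)} ⊆ N` (`hadm` + antitonicity); the cosets `t_{j(N)} N` are compatible, so `IsTempered.complete` yields
`s`; then `s⁻¹ t_i ∈ N · admKer_i` for every open normal `N`, hence `s⁻¹ t_i ∈ admKer_i` because `admKer_i` is closed
(`mem_of_forall_mem_openNormal_mul`). [cite: MochizukiSemiAnbd2006, Def 3.1(i) p.33] -/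
theorem hlimOn_of_admKer_nhds_one (d : X.GroupLevelData)
    (hadm : ∀ U ∈ 𝓝 (1 : ↥X.DeltaTemp), ∃ j, ((T.admKer j : Subgroup ↥X.DeltaTemp) : Set ↥X.DeltaTemp) ⊆ U)
    (J : Set ℕ) (i₀ : ℕ) (hJ : ∀ i, i₀ ≤ i → i ∈ J) (t : ℕ → X.PiTemp)
    (ht : ∀ i ∈ J, ∀ j ∈ J, i ≤ j → X.toHat ((t i)⁻¹ * t j) ∈ admKerHat X T i) :
    ∃ s : X.PiTemp, ∀ i ∈ J, X.toHat (s⁻¹ * t i) ∈ admKerHat X T i := by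
  classical
  have hG : IsTempered X.PiTemp := d.isTempered
  -- Cauchy condition read in `Π^temp_{X_K}`
  have ht' : ∀ i ∈ J, ∀ j ∈ J, i ≤ j → (t i)⁻¹ * t j ∈ admKerPi X T i :=
    fun i hi j hj hij => (toHat_mem_admKerHat_iff X T d i _).1 (ht i hi j hj hij)
  -- for each open normal `N`, an index `jN N ∈ J` with `admKer_{jN N} ≤ N`
  have hex : ∀ N : OpenNormalSubgroup X.PiTemp, ∃ j, j ∈ J ∧ admKerPi X T j ≤ N.toSubgroup := by
    intro N
    obtain ⟨j, hj⟩ := exists_admKerPi_le_openNormal X T hadm N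
    exact ⟨max j i₀, hJ _ (le_max_right _ _), (admKerPi_antitone X T (le_max_left _ _)).trans hj⟩
  choose jN hjNJ hjN using hex
  -- any two chosen representatives are congruent modulo the larger open normal subgroup
  have hcompat : ∀ N M : OpenNormalSubgroup X.PiTemp, N ≤ M → (t (jN M))⁻¹ * t (jN N) ∈ M.toSubgroup := by
    intro N M hNM
    rcases le_total (jN M) (jN N) with h | h
    · exact hjN M (ht' _ (hjNJ M) _ (hjNJ N) h)
    · have h1 : (t (jN N))⁻¹ * t (jN M) ∈ N.toSubgroup := hjN N (ht' _ (hjNJ N) _ (hjNJ M) h)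
      have h2 : ((t (jN N))⁻¹ * t (jN M))⁻¹ ∈ M.toSubgroup := M.toSubgroup.inv_mem (hNM h1)
      simpa using h2
  -- the compatible family of cosets and its limit `s`
  obtain ⟨s, hs⟩ := hG.complete (fun N => (t (jN N) : X.PiTemp ⧸ N.toSubgroup)) (by
    intro N M hNM g hg
    change (t (jN N) : X.PiTemp ⧸ N.toSubgroup) = (g : X.PiTemp ⧸ N.toSubgroup) at hg
    rw [QuotientGroup.eq] at hg ⊢
    have : (t (jN M))⁻¹ * g = ((t (jN M))⁻¹ * t (jN N)) * ((t (jN N))⁻¹ * g) := by group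
    rw [this]
    exact M.toSubgroup.mul_mem (hcompat N M hNM) (hNM hg))
  refine ⟨s, fun i hi => ?_⟩
  rw [toHat_mem_admKerHat_iff X T d]
  -- `s⁻¹ t_i ∈ N · admKer_i` for every open normal `N`
  refine mem_of_forall_mem_openNormal_mul hG (admKerPi X T i) (isClosed_admKerPi X T d i) fun N => ?_
  have hsN : (t (jN N))⁻¹ * s ∈ N.toSubgroup := by
    have := hs N
    change (t (jN N) : X.PiTemp ⧸ N.toSubgroup) = (s : X.PiTemp ⧸ N.toSubgroup) at this
    exact QuotientGroup.eq.mp this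
  have hsN' : s⁻¹ * t (jN N) ∈ N.toSubgroup := by
    have := N.toSubgroup.inv_mem hsN
    simpa using this
  rcases le_total (jN N) i with h | h
  · -- `admKer_i ≤ admKer_{jN N} ≤ N`: `s⁻¹ t_i ∈ N = N · 1`
    have h3 : (t (jN N))⁻¹ * t i ∈ N.toSubgroup := hjN N (ht' _ (hjNJ N) _ hi h)
    refine ⟨s⁻¹ * t i, ?_, 1, (admKerPi X T i).one_mem, mul_one _⟩
    have : s⁻¹ * t i = (s⁻¹ * t (jN N)) * ((t (jN N))⁻¹ * t i) := by group
    rw [this]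
    exact N.toSubgroup.mul_mem hsN' h3
  · -- `t_i⁻¹ t_{jN N} ∈ admKer_i`: `s⁻¹ t_i = (s⁻¹ t_{jN N}) · (t_{jN N}⁻¹ t_i) ∈ N · admKer_i`
    have h3 : (t i)⁻¹ * t (jN N) ∈ admKerPi X T i := ht' _ hi _ (hjNJ N) h
    refine ⟨s⁻¹ * t (jN N), hsN', (t (jN N))⁻¹ * t i, ?_, by group⟩
    have := (admKerPi X T i).inv_mem h3
    simpa using this

/-- **The binder `hlim` of `qTower_qDetectsTempered` PROVED from `IsTempered` + `hadm`**: every sequence in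
`Π^temp_{X_K}` that is Cauchy for the filtration by the `admKerHat_j` (in the inclusion order of the closures) is
interpolated. ([IUTchI] Prop 2.4(ii) p.51) [claim: Mochizuki2012, status: disputed] -/
theorem hlim_of_admKer_nhds_one (d : X.GroupLevelData)
    (hadm : ∀ U ∈ 𝓝 (1 : ↥X.DeltaTemp), ∃ j, ((T.admKer j : Subgroup ↥X.DeltaTemp) : Set ↥X.DeltaTemp) ⊆ U) :
    ∀ t : ℕ → X.PiTemp,
      (∀ j k, admKerHat X T k ≤ admKerHat X T j → X.toHat ((t j)⁻¹ * t k) ∈ admKerHat X T j) →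
      ∃ s : X.PiTemp, ∀ j, X.toHat (s⁻¹ * t j) ∈ admKerHat X T j := by
  intro t ht
  obtain ⟨s, hs⟩ := hlimOn_of_admKer_nhds_one X T d hadm Set.univ 0 (fun _ _ => Set.mem_univ _) t
    (fun i _ j _ hij => ht i j (admKerHat_antitone X T hij))
  exact ⟨s, fun j => hs j (Set.mem_univ _)⟩

/-! ### The re-keyed capstones for Prop. 2.4 (ii) at the genuine datum -/

section Tower

variable (d : X.GroupLevelData) (S : SpecialFibreData (X.toTemperedArithmeticGroup d))
  (h36 : S.Gc.Prop36Hypotheses)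
  (Sigma SigmaHat : Set ℕ) (hsub : Sigma ⊆ SigmaHat) (hne : Sigma.Nonempty)
  (hprime : ∀ q ∈ SigmaHat, q.Prime) (hp : p ∉ Sigma)
  (TpH : Subgroup S.chart.G)
  (HatH : Subgroup (TemperedGraphGroupData.exists_completion_of_prop36 S.Gc h36 S.chart).choose)
  (hle : TpH.map (TemperedGraphGroupData.exists_completion_of_prop36 S.Gc h36
    S.chart).choose_spec.choose.toMonoidHom ≤ HatH)
  (cuspMeetsH : {x : X.Pt // X.IsCusp x} → Prop)
  (hP0 : ∀ i, (admKerPi X T i).Normal)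

/-- **(INV) `QDetectsTempered` for the genuine quotient tower from (P0) + `hcof` + `hadm`** — the tempered
completeness `hlim` of `qTower_qDetectsTempered` is discharged by `hlim_of_admKer_nhds_one`.
([IUTchI] Prop 2.4(ii) p.51) [claim: Mochizuki2012, status: disputed] -/
theorem qTower_qDetectsTempered_of_admKer_nhds_one
    (hcof : ∀ U : Subgroup X.DeltaTemp, IsOpen (U : Set X.DeltaTemp) → U.Normal → U.FiniteIndex →
      ∃ i, T.N i ≤ U)
    (hadm : ∀ U ∈ 𝓝 (1 : ↥X.DeltaTemp), ∃ j, ((T.admKer j : Subgroup ↥X.DeltaTemp) : Set ↥X.DeltaTemp) ⊆ U) :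
    (qTowerOfSpecialFibreTower X T d S h36 Sigma SigmaHat hsub hne hprime hp TpH HatH hle cuspMeetsH
      hP0).QDetectsTempered :=
  qTower_qDetectsTempered X T d S h36 Sigma SigmaHat hsub hne hprime hp TpH HatH hle cuspMeetsH hP0 hcof
    (hlim_of_admKer_nhds_one X T d hadm)

/-- **[IUTchI] Prop. 2.4 (ii) AS TYPED at the genuine 𝔛-datum from the per-level arithmetic Prop. 2.1
(`LevelObservation`) + (P0) + `hcof` + `hadm`** — `prop24ii_ofSpecialFibre_of_qTower` with `hlim` discharged.
([IUTchI] Prop 2.4(ii) pp.50-51) [claim: Mochizuki2012, status: disputed] -/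
theorem prop24ii_ofSpecialFibre_of_admKer_nhds_one
    (hcof : ∀ U : Subgroup X.DeltaTemp, IsOpen (U : Set X.DeltaTemp) → U.Normal → U.FiniteIndex →
      ∃ i, T.N i ≤ U)
    (hadm : ∀ U ∈ 𝓝 (1 : ↥X.DeltaTemp), ∃ j, ((T.admKer j : Subgroup ↥X.DeltaTemp) : Set ↥X.DeltaTemp) ⊆ U)
    (hLev : (qTowerOfSpecialFibreTower X T d S h36 Sigma SigmaHat hsub hne hprime hp TpH HatH hle
      cuspMeetsH hP0).LevelObservation) :
    (ofSpecialFibre X d S h36 Sigma SigmaHat hsub hne hprime hp TpH HatH hle cuspMeetsH).Prop24ii :=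
  prop24ii_ofSpecialFibre_of_qTower X T d S h36 Sigma SigmaHat hsub hne hprime hp TpH HatH hle cuspMeetsH hP0
    hcof (hlim_of_admKer_nhds_one X T d hadm) hLev

end Tower

end OfSpecialFibre

end StableCurveTemperedData

end Literature.IUT.HodgeTheaters

end
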